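import Summits.ABC.IUTFork.Joshi.Dictionary
import Summits.ABC.IUTFork.Joshi.ArithTeichmullerAction
import Summits.ABC.IUTFork.Cor312PilotKummerCompatNonVacuity
import HarnessLib

/-!
# Dictionary instance from [J-I]: Joshi's `Aut_{𝒪_E}(𝒢(𝒪_F))`-action on the points of `𝒴_{F,E}` as the (Pt, Move, act)
# of `Joshi.Dictionary`; `StdReachable ↔ orbit`; the missing data `datum`/`real`; a DEGENERATE joint model (one point)

Block E dictionary file (rung LADDER-ABC:A2.E; seat abc-iut-E-t1; E-PLAN R4b/R10/R14: OUR frozen `Cor312*`/`Thm311*`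
declarations are bound to Joshi's objects ONLY in `Joshi/Dictionary*.lean` / `Joshi/Test*.lean`). TAKES NO SIDE on
[IUTchIII] Cor. 3.12 or on any author; typed ≠ proved ≠ endorsed; a conditional derivation reads «S follows from
<typed hypotheses> as typed», nothing more.

WHAT THIS FILE DOES.
* §1 `UntiltPoints.toDictionary` — instantiates the abstract `(Pt, Move, act)` of abc-iut-E-plan's `Joshi.Dictionary S`
  (Joshi/Dictionary.lean: "his Ind2 = change of point `y ∈ 𝒴` («ℚ_p-linear isomorphisms σ : Ĝ_m(𝒪_{C♭}) → Ĝ_m(𝒪_{C♭})»,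
  [J-III] p.91 l.35–50; [J-I] Thm. th:main3 / Cor. co:action)") by the TYPED [J-I] objects of
  `ArithTeichmullerAction`: `Pt := D.Pt` (degree-one points of `𝒴_{F,E}`), `Move := D.Aut = Aut_{𝒪_E}(𝒢(𝒪_F))`,
  `act := D.ptAct` (the DEFINED action of ATS I Thm (th:main3) (3)–(4)). The two remaining fields `datum`
  (realisation of a point as a Kummer datum in the star packets) and `real` (realisation of `σ` as a family of
  packet automorphisms) have NO counterpart in [J-I] (ATS I produces no data on [IUTchIII]'s tensor packets) and
  stay PARAMETERS — the E1-side MISSING DATA (plan/E OBJECTS rows O-002/O-003, D-04/D-10).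
* §2 For this instance the dictionary's `StdReachable` (a list of moves carrying `base` to `std`) is EXACTLY
  «`std` lies in the `Aut_{𝒪_E}(𝒢(𝒪_F))`-orbit of `base`» (`stdReachable_iff_mem_ptOrbit`; the action is a group
  action, `ptAct_one/_mul`), and `MovesAreInd` reads «every `σ ∈ Aut_{𝒪_E}(𝒢(𝒪_F))` is realised inside
  `⟨(Ind1) ∪ (Ind2)⟩`» — the sentence E-PLAN R10/X-06 locates (Joshi's `σ` DILATES valuations,
  `UntiltPoints.ActionDilates` / [J-IIp] Thm. 6.9.1, while (Ind1)/(Ind2) at an isometric instantiation preserve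
  log-volumes): recorded here by name, tested in `Joshi/TestHarness.lean` (`not_untiltChange_of_logvolInvariant`), not
  re-tested.
* §3 A DEGENERATE JOINT MODEL on [J-I] carriers (the X-04-min floor of plan/E OBJECTS, labelled degenerate): the
  ONE-POINT signature `onePoint p` (one holomorphic structure, residue field `ℂ_p`; `𝒢 := 𝔽₂` over `𝒪_E := 𝔽₂`, so
  `(𝒢 − {0})/𝒪_E^×` is a point), the dictionary `onePointDictionary` on it with `datum := (S.D n).Ψ` and `real := 1`,
  for which `BaseIsThetaPilot`, `MovesAreInd`, `DatumEquivariant`, `StdReachable` — hence Y1 = `AnsatzWithinInd` — HOLD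
  for EVERY situation (`ansatzWithinInd_onePoint`), and at abc-iut-w5-d247's link-identified setting P♭
  (`NaiveWitness.linkIdSetting`, q-datum = the Θ-splitting monoid) also Y2 = `StandardPointIsQPilot`, so that X-01
  FIRES: `S` and the printed Statement hold there (`onePoint_satisfiable`: typed Thm 3.11 Statement ∧ BridgeHyps ∧
  PinnedRegions3 ∧ Y1 ∧ Y2 ∧ S ∧ Statement jointly). HONEST SCOPE: one holomorphic structure, trivial move group —
  it shows only that the binders of X-01 are jointly satisfiable over the [J-I] carriers; a CONTENTFUL model needs a
  points-signature with `ExistsNonIsomorphic`/`ActionDilates` ([KedlayaTemkin2018]; nothing in the tree constructs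
  one) and is E-cx's X-04/X-07; the tree's floor of record is `TestDictionaryFloor.constDictionary` (`Move := PEmpty`)
  — the present model differs only in that its `(Pt, Move, act)` ARE the [J-I] instance. COUNTERMODEL side (X-02):
  at `PinnedWitness.pinnedSetting` Y1 ∧ Y2 fails for EVERY dictionary — hence for every `toDictionary` — by
  `DictionaryHarnessBridge.pinnedSetting_not_ansatzWithinInd_and_stdIsQPilot` (cited BY NAME, not re-proved).
LOCATORS: [J-I] is cited by the 2021 corpus-TeX render (TeX labels + chunks) as in `ArithTeichmullerAction`; v4
(24 Feb 2025, version of record, render `plan/repair/lit/renders/Joshi-ATS1-2106.11452v4-…`) concordance: Thm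
(th:main3) = Thm 5.21.1 (p.34–35), Cor (co:action-on-cpt-cat) = Thm 5.24.1 (p.35–36), 𝔍(X,E) = Def 5.1.1 / 5.11.1
(p.22, p.30), valuation scaling = Thm 5.4.1 / Cor 5.4.2 (p.26–27); full table `HOME/plan/E/t1/CONCORDANCE-J1-v4.md`.
[claim: Joshi2021ATS1, status: disputed] [claim: Joshi2024ATS3, status: disputed]
-/

noncomputable section

open Set

namespace Summit.ABC.IUTFork.Joshi

open Summit.ABC.IUTFork.Thm311 Summit.ABC.IUTFork.Cor312 Summit.ABC.IUTFork.Cor312Vol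

variable {p : ℕ} [Fact p.Prime] {𝒪E : Type} [CommRing 𝒪E] {T : ThetaIndex}

/-! ## 1. The instance: (Pt, Move, act) := (|𝒴_{F,E}|, Aut_{𝒪_E}(𝒢(𝒪_F)), ptAct) -/

namespace UntiltPoints

variable (D : UntiltPoints p 𝒪E) (S : LatticeSituation T)

/-- **The [J-I] instance of the dictionary's move data.** Points := the degree-one points of `𝒴_{F,E}`; moves :=
`Aut_{𝒪_E}(𝒢(𝒪_F))`; action := ATS I Thm (th:main3) (3)–(4) / Cor (co:action-on-cpt-cat) as DEFINED in
`ArithTeichmullerAction` (`ptAct`); `base`, `std` two chosen points (the holomorphic structure of the line's Θ-pilot and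
Joshi's standard point); `datum`, `real` = the MISSING DATA (no [J-I] counterpart), taken as parameters.
[claim: Joshi2024ATS3, status: disputed] -/
def toDictionary (base std : D.Pt) (datum : D.Pt → ∀ v : T.V, v ∈ T.Vbad → Set (S.L.StarPacket v))
    (real : D.Aut → S.L.PacketAut) : Dictionary S where
  Pt := D.Pt
  Move := D.Aut
  act := D.ptAct
  base := base
  std := std
  datum := datum
  real := real

/-- The orbit of a point under `Aut_{𝒪_E}(𝒢(𝒪_F))`. [claim: Joshi2021ATS1, status: disputed] -/
def ptOrbit (y₀ : D.Pt) : Set D.Pt := {y | ∃ σ : D.Aut, y = D.ptAct σ y₀}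

/-- `y₀` lies in its orbit. [folklore] -/
theorem mem_ptOrbit_self (y₀ : D.Pt) : y₀ ∈ D.ptOrbit y₀ := ⟨1, (D.ptAct_one y₀).symm⟩

/-- A list of moves acts as the product of its members (the action is a group action). [folklore] -/
theorem foldr_ptAct_eq_ptAct_prod (gs : List D.Aut) (y : D.Pt) :
    gs.foldr D.ptAct y = D.ptAct gs.prod y := by
  induction gs with
  | nil => simp [D.ptAct_one]
  | cons g gs ih => simp [ih, D.ptAct_mul]

/-! ## 2. `StdReachable` ↔ orbit; what `MovesAreInd` says for this instance -/

variable {D S}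
variable {base std : D.Pt} {datum : D.Pt → ∀ v : T.V, v ∈ T.Vbad → Set (S.L.StarPacket v)}
  {real : D.Aut → S.L.PacketAut}

/-- For the [J-I] instance, the dictionary's `StdReachable` («`std` is reached from `base` by finitely many moves»)
is EXACTLY «`std` lies in the `Aut_{𝒪_E}(𝒢(𝒪_F))`-orbit of `base`». [folklore] -/
theorem stdReachable_iff_mem_ptOrbit :
    StdReachable (D.toDictionary S base std datum real) ↔ std ∈ D.ptOrbit base := by
  constructor
  · rintro ⟨gs, hgs⟩
    change List D.Aut at gs
    change gs.foldr D.ptAct base = std at hgs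
    exact ⟨gs.prod, hgs.symm.trans (D.foldr_ptAct_eq_ptAct_prod gs base)⟩
  · rintro ⟨σ, hσ⟩
    exact ⟨[σ], by simpa [toDictionary] using hσ.symm⟩

/-- For the [J-I] instance, `MovesAreInd` reads: EVERY `σ ∈ Aut_{𝒪_E}(𝒢(𝒪_F))` is realised by a family of packet
automorphisms inside `⟨(Ind1) ∪ (Ind2)⟩` (unfolding; the sentence X-06 of plan/E locates against
`UntiltPoints.ActionDilates`). [folklore] -/
theorem movesAreInd_toDictionary_iff :
    MovesAreInd (D.toDictionary S base std datum real) ↔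
      ∀ σ : D.Aut, real σ ∈ Subgroup.closure (S.L.Ind1Family ∪ S.L.Ind2Family) :=
  Iff.rfl

/-- For the [J-I] instance, `DatumEquivariant` reads: moving the holomorphic structure by `σ` transports the Kummer
datum by `real σ` (unfolding). [folklore] -/
theorem datumEquivariant_toDictionary_iff :
    DatumEquivariant (D.toDictionary S base std datum real) ↔
      ∀ (σ : D.Aut) (y : D.Pt) (v : T.V) (hv : v ∈ T.Vbad),
        datum (D.ptAct σ y) v hv = S.L.starAut (real σ) v '' datum y v hv :=
  Iff.rfl

/-- X-01 on the instance (E-plan's kernel glue, restated so the test line can name [J-I] carriers): if `std` is in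
the orbit of `base`, the base datum is the line's Θ-datum, moves are indeterminacies acting equivariantly (Y1's
components) and the standard-point datum is the q-pilot datum up to `ρ` (Y2), then `S`. «S follows from
(BaseIsThetaPilot, MovesAreInd, DatumEquivariant, std ∈ orbit, StandardPointIsQPilot) as typed.»
[claim: Joshi2024ATS3, status: disputed] -/
theorem pilotKummerIndRelated_of_orbit {P : Cor312.Setting S.toSituation}
    (ρ : (∀ v : T.V, v ∈ T.Vbad → Set (S.L.StarPacket v)) → ∀ (j : T.Label) (vQ : T.VQ), Set (S.L.Packet j vQ))
    (qK : ∀ v : T.V, v ∈ T.Vbad → Set (S.L.StarPacket v))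
    (hB : BaseIsThetaPilot (D.toDictionary S base std datum real) (P := P))
    (hM : MovesAreInd (D.toDictionary S base std datum real))
    (hE : DatumEquivariant (D.toDictionary S base std datum real)) (horb : std ∈ D.ptOrbit base)
    (hY2 : StandardPointIsQPilot ρ qK (D.toDictionary S base std datum real)) :
    PilotKummerIndRelated S P ρ qK :=
  pilotKummerIndRelated_of_ansatzWithinInd ρ qK _
    (ansatzWithinInd_of_moves ρ _ hB hM hE (stdReachable_iff_mem_ptOrbit.2 horb)) hY2

end UntiltPoints

/-! ## 3. A DEGENERATE joint model on [J-I] carriers (X-02 side: `DictionaryHarnessBridge`, by name) -/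

section OnePoint

variable (p)

/-- `(𝔽₂ − {0})/𝔽₂^×` is a point: every class is the class of `1`. [folklore] -/
theorem projPoints_zmod2_eq (x : ProjPoints (ZMod 2) (ZMod 2)) :
    x = Quotient.mk (unitRel (ZMod 2) (ZMod 2)) ⟨1, one_ne_zero⟩ := by
  induction x using Quotient.inductionOn with
  | h g =>
    apply Quotient.sound
    obtain ⟨g, hg⟩ := g
    refine ⟨1, ?_⟩
    show (1 : (ZMod 2)ˣ) • g = 1
    rw [one_smul]
    revert g
    decide

/-- The embedding `Q̄_p ↪ ℂ_p` (Mathlib's completion map on `PadicAlgCl p = AlgebraicClosure ℚ_[p]`). [folklore] -/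
def algClPadicComplex : AlgebraicClosure ℚ_[p] →+* (Untilt.padicComplex p).K :=
  show PadicAlgCl p →+* ℂ_[p] from UniformSpace.Completion.coeRingHom

/-- … is continuous on `ℚ_p`. [folklore] -/
theorem continuous_algClPadicComplex :
    Continuous fun x : ℚ_[p] => algClPadicComplex p (algebraMap ℚ_[p] (AlgebraicClosure ℚ_[p]) x) :=
  (UniformSpace.Completion.continuous_coe _).comp (continuous_algebraMap ℚ_[p] (PadicAlgCl p))

/-- **The ONE-POINT points-signature** `onePoint p : UntiltPoints p (ZMod 2)` — one holomorphic structure with residue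
field `ℂ_p`, `𝒢 := 𝔽₂` over `𝒪_E := 𝔽₂` (so `(𝒢 − {0})/𝒪_E^×` is a point), Frobenius the identity. DEGENERATE but
honest inhabitant of the signature, used only for joint satisfiability (X-04-min floor on [J-I] carriers). [folklore] -/
def onePoint : UntiltPoints p (ZMod 2) where
  Pt := Unit
  untilt _ := Untilt.padicComplex p
  frob := Equiv.refl Unit
  algCl _ := algClPadicComplex p
  continuous_algCl _ := continuous_algClPadicComplex p
  G := ZMod 2
  topologicalSpace := ⊥
  ptEquiv :=
    { toFun := fun _ => Quotient.mk (unitRel (ZMod 2) (ZMod 2)) ⟨1, one_ne_zero⟩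
      invFun := fun _ => ()
      left_inv := fun _ => rfl
      right_inv := fun x => (projPoints_zmod2_eq x).symm }

variable {p}

/-- **The one-point dictionary**: the unique holomorphic structure is both `base` and `std`; its datum is the line's
Θ-splitting-monoid datum `(S.D n).Ψ`; every move is realised by the identity family. [folklore] -/
def onePointDictionary (S : LatticeSituation T) (n : ℤ) : Dictionary S :=
  (onePoint p).toDictionary S (by exact ()) (by exact ()) (fun _ => (S.D n).Ψ) fun _ => 1

variable (S : LatticeSituation T) (P : Cor312.Setting S.toSituation)
  (ρ : (∀ v : T.V, v ∈ T.Vbad → Set (S.L.StarPacket v)) → ∀ (j : T.Label) (vQ : T.VQ), Set (S.L.Packet j vQ))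

/-- `BaseIsThetaPilot` holds for the one-point dictionary (by construction). [folklore] -/
theorem baseIsThetaPilot_onePoint : BaseIsThetaPilot (onePointDictionary (p := p) S P.n) (P := P) := rfl

/-- `MovesAreInd` holds for the one-point dictionary (the identity family lies in every subgroup). [folklore] -/
theorem movesAreInd_onePoint : MovesAreInd (onePointDictionary (p := p) S P.n) := fun _ => one_mem _

/-- `DatumEquivariant` holds for the one-point dictionary (the identity family transports every datum to itself).
[folklore] -/
theorem datumEquivariant_onePoint : DatumEquivariant (onePointDictionary (p := p) S P.n) := by
  intro g z v hv
  show (S.D P.n).Ψ v hv = S.L.starAut 1 v '' (S.D P.n).Ψ v hv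
  have : S.L.starAut (1 : S.L.PacketAut) v = LinearEquiv.refl ℚ _ := by
    ext x j
    rfl
  rw [this]
  exact (Set.image_id _).symm

/-- `StdReachable` holds for the one-point dictionary (`std = base`, empty list of moves). [folklore] -/
theorem stdReachable_onePoint : StdReachable (onePointDictionary (p := p) S P.n) := ⟨[], rfl⟩

/-- Hence **Y1 = `AnsatzWithinInd` HOLDS for the one-point dictionary, in EVERY situation** (E-plan's
`ansatzWithinInd_of_moves`): degenerate-floor witness that Y1's four components are jointly satisfiable on [J-I]
carriers. [folklore] -/
theorem ansatzWithinInd_onePoint : AnsatzWithinInd ρ (onePointDictionary (p := p) S P.n) (P := P) :=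
  ansatzWithinInd_of_moves ρ _ (baseIsThetaPilot_onePoint S P) (movesAreInd_onePoint S P)
    (datumEquivariant_onePoint S P) (stdReachable_onePoint S P)

open Cor312Vol.NaiveWitness Cor312Vol.GluedMonoids.Naive

variable (p) (q : ℕ) [Fact q.Prime]

/-- At abc-iut-w5-d247's LINK-IDENTIFIED pinned setting P♭ (`linkIdSetting q`: q-datum `{(±q^{j²})_j}` = the line's
Θ-splitting monoid, operator `ballOfMonoid q`) **Y2 = `StandardPointIsQPilot` HOLDS** for the one-point dictionary
(the standard-point datum IS the q-datum). [folklore] -/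
theorem standardPointIsQPilot_onePoint_linkId :
    StandardPointIsQPilot (ballOfMonoid q) (fun v _ => Psi q v)
      (onePointDictionary (p := p) (naiveFull q).toLatticeSituation (linkIdSetting q).n) :=
  fun _ _ => rfl

/-- **JOINT SATISFIABILITY on [J-I] carriers (DEGENERATE FLOOR)**: a points-signature, a typed Thm-3.11 situation
with its Statement, a Cor.-3.12 setting with bridge hypotheses and the THREE PINS, and a dictionary on the [J-I]
(Pt, Move, act) for which Y1 (`AnsatzWithinInd`), Y2 (`StandardPointIsQPilot`), `S = PilotKummerIndRelated` and the
printed Statement ALL HOLD (one point over `ℂ_p`; P♭ over `naiveFull 2`; X-01 fires). One holomorphic structure,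
trivial move group: NOT a contentful model (E-cx X-04/X-07). [folklore] -/
theorem onePoint_satisfiable :
    ∃ (𝒪E : Type) (_ : CommRing 𝒪E) (D : UntiltPoints p 𝒪E) (T : ThetaIndex) (F : FullSituation T)
      (P : Cor312.Setting F.toLatticeSituation.toSituation)
      (ρ : (∀ v : T.V, v ∈ T.Vbad → Set (F.L.StarPacket v)) → ∀ (j : T.Label) (vQ : T.VQ), Set (F.L.Packet j vQ))
      (qK : ∀ v : T.V, v ∈ T.Vbad → Set (F.L.StarPacket v))
      (datum : D.Pt → ∀ v : T.V, v ∈ T.Vbad → Set (F.L.StarPacket v)) (real : D.Aut → F.L.PacketAut)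
      (base std : D.Pt),
      F.Statement ∧ BridgeHyps P ∧ PinnedRegions3 F.toLatticeSituation P ρ qK ∧
        AnsatzWithinInd ρ (D.toDictionary F.toLatticeSituation base std datum real) (P := P) ∧
        StandardPointIsQPilot ρ qK (D.toDictionary F.toLatticeSituation base std datum real) ∧
        PilotKummerIndRelated F.toLatticeSituation P ρ qK ∧ P.Statement := by
  haveI : Fact (Nat.Prime 2) := ⟨Nat.prime_two⟩
  refine ⟨ZMod 2, inferInstance, onePoint p, _, naiveFull 2, linkIdSetting 2, ballOfMonoid 2, fun v _ => Psi 2 v,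
    fun _ => ((naiveFull 2).D (linkIdSetting 2).n).Ψ, fun _ => 1, (by exact ()), (by exact ()),
    naiveFull_statement 2, linkId_bridgeHyps 2, linkId_pinnedRegions3 2,
    ansatzWithinInd_onePoint (p := p) _ _ _, standardPointIsQPilot_onePoint_linkId p 2, ?_,
    linkId_statement_via_pilotKummerCompat 2⟩
  exact pilotKummerIndRelated_of_ansatzWithinInd _ _ _ (ansatzWithinInd_onePoint (p := p) _ _ _)
    (standardPointIsQPilot_onePoint_linkId p 2)

end OnePoint

end Summit.ABC.IUTFork.Joshi

end
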